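import Literature.Order.Ordinal.NaturalSum
import Mathlib.SetTheory.Ordinal.Arithmetic
import HarnessLib

/-!
# Natural sums below `ω²`: `(ω·m + k) ⊕ (ω·n + l) = ω·(m + n) + (k + l)` (Clark 2015, §1.2, Thm. 3 / Hessenberg's formula)

Topic `Literature/Order/Ordinal`, namespace `Literature.Order.Ordinal`.  THEOREMS ONLY (no `def`, no instance, no named fact),
all proved, on top of `NaturalSum.lean` (`nadd α β = α ⊕ β` by the Brookfield recursion, `nadd_le_iff`, `nadd_natCast`,
`add_le_nadd`).  The Hessenberg description of `⊕` through the Cantor normal form is proved here for the ordinals below `ω²`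
only — the case used by `Literature/Algebra/EuclideanDomain/` (Clark's Thm. 27 (a): «`⊕ᵢ₌₁ʳ e(Rᵢ) ⊕ ℓ(A) = rω + ℓ(A)`» for
`e(Rᵢ) = ω`).

## Source (read at the page)

P. L. Clark, *A note on Euclidean order types*, Order **32** (2015) [Clark2015EuclideanOrderTypes] (materialised
`paper:arxiv-1208.0977`, p0003), VERBATIM.  «We recall the following, a version of the Cantor normal form: for any `α, β ∈ Ord`
there are `γ₁, …, γ_r ∈ Ord`, `r ∈ ℤ⁺` and `m₁, …, m_r, n₁, …, n_r ∈ ℕ` with `α = m₁ω^{γ₁} + … + m_rω^{γ_r}`,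
`β = n₁ω^{γ₁} + … + n_rω^{γ_r}`. … We may then define the Hessenberg sum
`α ⊕_H β = (m₁ + n₁)ω^{γ₁} + … + (m_r + n_r)ω^{γ_r}`.  **Theorem 3.** For all `α, β ∈ Ord`, `α ⊕_B β = α ⊕_H β`.  Proof. See
[Brookfield02].»  «**Proposition 4.** … a) If `β < ω`, then `α + β = α ⊕ β`.»  (Proof of Thm. 27 (a), p0007:
«`rω + ℓ(A) = e₁(R) + … + e_r(R) + e(A) ≤ e(R) ≤ ⊕ᵢ₌₁ʳ e(Rᵢ) ⊕ ℓ(A) = rω + ℓ(A)`».)  Here `mω^1 + kω^0` is the ordinal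
`ω·m + k` (`m` copies of `ω`, then `k`).

## What is formalised

* `nadd_add_natCast` / `add_natCast_nadd`: `α ⊕ (β + n) = (α ⊕ β) + n` (Prop. 4 (a) iterated from `nadd_add_one`).
* `lt_omega0_mul_natCast_iff`: the ordinals below `ω·m` are the `ω·i + k`, `i < m`, `k < ω` (Cantor normal form below `ω²`).
* **`nadd_omega0_mul_natCast`: `ω·m ⊕ ω·n = ω·(m + n)`** (Theorem 3 with `γ₁ = 1`: by the recursion, every `α′ ⊕ ω·n` with
  `α′ = ω·i + k < ω·m` equals `ω·(i + n) + k < ω·(m + n)` by induction on `m + n`, and `ω·(m + n) = ω·m + ω·n ≤ ω·m ⊕ ω·n`).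
* **`nadd_omega0_mul_add_natCast`: `(ω·m + k) ⊕ (ω·n + l) = ω·(m + n) + (k + l)`** (Theorem 3 with `γ ∈ {1, 0}`), and the
  special cases `nadd_omega0_omega0 : ω ⊕ ω = ω·2`, `nadd_omega0_mul_natCast_omega0`.
-- TODO(general form): Theorem 3 for arbitrary ordinals (Cantor normal form in general; needs `⊕` associativity and the
-- interaction with `ω^γ`) is not formalised.

## Mathlib / tree search

Mathlib: `Ordinal.div_add_mod`, `Ordinal.lt_mul_iff_div_lt`, `Ordinal.mod_lt`, `Ordinal.lt_omega0`, `Ordinal.mul_succ`, `Ordinal.mul_add`,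
`mul_le_mul_right` (ordinal multiplication is monotone: `b ≤ c → a·b ≤ a·c`), `add_lt_add_iff_left`, `Ordinal.natCast_lt_omega0`; no `Ordinal.nadd` at this pin
(see `NaturalSum.lean`).  Tree: `NaturalSum.lean` (`nadd_le_iff`, `nadd_comm`, `nadd_natCast`, `nadd_add_one`, `add_le_nadd`,
`nadd_lt_nadd_left/right`, `nadd_eq_add_of_lt_omega0`, `nadd_one_omega0`); `rg "nadd (ω"`/`"omega0_mul"` in `Literature/Order` →
nothing else.
-/

namespace Literature.Order.Ordinal

open _root_.Ordinal _root_.Order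

universe u

/-! ## §1 Shifting by a natural number -/

/-- `α ⊕ (β + n) = (α ⊕ β) + n` for a natural number `n` (Prop. 4 (a), iterated successor steps).
[cite: Clark2015EuclideanOrderTypes, Prop. 4 (a)] -/
theorem nadd_add_natCast (a b : Ordinal.{u}) : ∀ n : ℕ, nadd a (b + n) = nadd a b + n
  | 0 => by rw [Nat.cast_zero, add_zero, add_zero]
  | n + 1 => by rw [Nat.cast_succ, ← add_assoc, nadd_add_one, nadd_add_natCast a b n, add_assoc]

/-- `(α + n) ⊕ β = (α ⊕ β) + n` for a natural number `n`. [cite: Clark2015EuclideanOrderTypes, Prop. 4 (a)] -/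
theorem add_natCast_nadd (a b : Ordinal.{u}) (n : ℕ) : nadd (a + n) b = nadd a b + n := by
  rw [nadd_comm, nadd_add_natCast, nadd_comm]

/-! ## §2 The ordinals below `ω·m` -/

/-- **Cantor normal form below `ω²`**: `α < ω·m` (`m` a natural number) iff `α = ω·i + k` with `i < m` and `k` natural
numbers. [cite: Clark2015EuclideanOrderTypes, §1.2 («a version of the Cantor normal form»)] -/
theorem lt_omega0_mul_natCast_iff {a : Ordinal.{u}} {m : ℕ} :
    a < ω * m ↔ ∃ i : ℕ, i < m ∧ ∃ k : ℕ, a = ω * i + k := by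
  constructor
  · intro h
    have hi : a / ω < (m : Ordinal.{u}) := (Ordinal.lt_mul_iff_div_lt omega0_ne_zero).1 h
    obtain ⟨i, hi'⟩ := Ordinal.lt_omega0.1 (hi.trans (natCast_lt_omega0 m))
    obtain ⟨k, hk⟩ := Ordinal.lt_omega0.1 (Ordinal.mod_lt a omega0_ne_zero)
    refine ⟨i, ?_, k, ?_⟩
    · rw [hi'] at hi
      exact_mod_cast hi
    · rw [← hi', ← hk, Ordinal.div_add_mod]
  · rintro ⟨i, hi, k, rfl⟩
    calc ω * i + k < ω * i + ω := (add_lt_add_iff_left _).2 (natCast_lt_omega0 k)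
      _ = ω * ((i + 1 : ℕ) : Ordinal.{u}) := by rw [Nat.cast_succ, mul_add_one]
      _ ≤ ω * m := mul_le_mul_right (by exact_mod_cast hi) _

/-! ## §3 `ω·m ⊕ ω·n = ω·(m + n)` -/

/-- **Theorem 3 (Hessenberg's formula) for multiples of `ω`: `ω·m ⊕ ω·n = ω·(m + n)`** — by the recursion: for
`α′ = ω·i + k < ω·m`, `α′ ⊕ ω·n = ω·(i + n) + k < ω·(m + n)` (induction on `m + n`), symmetrically in the second variable,
and `ω·(m + n) = ω·m + ω·n ≤ ω·m ⊕ ω·n`. [cite: Clark2015EuclideanOrderTypes, §1.2 Thm. 3 (with `γ₁ = 1`)] -/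
theorem nadd_omega0_mul_natCast (m n : ℕ) :
    nadd (ω * m : Ordinal.{u}) (ω * n) = ω * ((m + n : ℕ) : Ordinal.{u}) := by
  -- strong induction on `m + n`
  suffices H : ∀ s : ℕ, ∀ m n : ℕ, m + n = s →
      nadd (ω * m : Ordinal.{u}) (ω * n) = ω * ((m + n : ℕ) : Ordinal.{u}) from H _ m n rfl
  intro s
  induction s using Nat.strong_induction_on with
  | _ s ih =>
    intro m n hs
    -- the bound `ω·(i + n) + k < ω·(m + n)` for `i < m`
    have step : ∀ i k m' n' : ℕ, i < m' →
        ω * ((i + n' : ℕ) : Ordinal.{u}) + k < ω * ((m' + n' : ℕ) : Ordinal.{u}) := by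
      intro i k m' n' hi
      calc ω * ((i + n' : ℕ) : Ordinal.{u}) + k
          < ω * ((i + n' : ℕ) : Ordinal.{u}) + ω := (add_lt_add_iff_left _).2 (natCast_lt_omega0 k)
        _ = ω * ((i + n' + 1 : ℕ) : Ordinal.{u}) := by rw [Nat.cast_succ, mul_add_one]
        _ ≤ ω * ((m' + n' : ℕ) : Ordinal.{u}) := mul_le_mul_right (by exact_mod_cast (by omega : i + n' + 1 ≤ m' + n')) _
    apply le_antisymm
    · rw [nadd_le_iff]
      constructor
      · intro a' ha'
        obtain ⟨i, hi, k, rfl⟩ := lt_omega0_mul_natCast_iff.1 ha'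
        rw [add_natCast_nadd, ih (i + n) (by omega) i n rfl]
        exact step i k m n hi
      · intro b' hb'
        obtain ⟨j, hj, l, rfl⟩ := lt_omega0_mul_natCast_iff.1 hb'
        rw [nadd_add_natCast, ih (m + j) (by omega) m j rfl, Nat.add_comm m j, Nat.add_comm m n]
        exact step j l n m hj
    · calc ω * ((m + n : ℕ) : Ordinal.{u}) = ω * m + ω * n := by rw [Nat.cast_add, mul_add]
        _ ≤ nadd (ω * m) (ω * n) := add_le_nadd _ _

/-- **Theorem 3 below `ω²`: `(ω·m + k) ⊕ (ω·n + l) = ω·(m + n) + (k + l)`** for natural numbers `m, n, k, l` — the Hessenberg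
sum `(m + n)ω^1 + (k + l)ω^0` of `mω + k` and `nω + l`. [cite: Clark2015EuclideanOrderTypes, §1.2 Thm. 3 (with `γ ∈ {1, 0}`)
and Prop. 4 (a)] -/
theorem nadd_omega0_mul_add_natCast (m k n l : ℕ) :
    nadd (ω * m + k : Ordinal.{u}) (ω * n + l) = ω * ((m + n : ℕ) : Ordinal.{u}) + ((k + l : ℕ) : Ordinal.{u}) := by
  rw [nadd_add_natCast, add_natCast_nadd, nadd_omega0_mul_natCast, add_assoc, ← Nat.cast_add]

/-- `ω ⊕ ω = ω·2`. [cite: Clark2015EuclideanOrderTypes, §1.2 Thm. 3] -/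
theorem nadd_omega0_omega0 : nadd (ω : Ordinal.{u}) ω = ω * 2 := by
  have h := nadd_omega0_mul_natCast.{u} 1 1
  rwa [Nat.cast_one, mul_one] at h

/-- `ω·m ⊕ ω = ω·(m + 1)` (the inductive step of «`⊕ᵢ₌₁ʳ e(Rᵢ) = rω`» for `e(Rᵢ) = ω`).
[cite: Clark2015EuclideanOrderTypes, §1.2 Thm. 3 and proof of Thm. 27 (a)] -/
theorem nadd_omega0_mul_natCast_omega0 (m : ℕ) :
    nadd (ω * m : Ordinal.{u}) ω = ω * ((m + 1 : ℕ) : Ordinal.{u}) := by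
  have h := nadd_omega0_mul_natCast.{u} m 1
  rwa [Nat.cast_one, mul_one] at h

/-- `ω ⊕ ω·n = ω·(1 + n)`. [cite: Clark2015EuclideanOrderTypes, §1.2 Thm. 3 and proof of Thm. 27 (a)] -/
theorem nadd_omega0_omega0_mul_natCast (n : ℕ) :
    nadd (ω : Ordinal.{u}) (ω * n) = ω * ((1 + n : ℕ) : Ordinal.{u}) := by
  have h := nadd_omega0_mul_natCast.{u} 1 n
  rwa [Nat.cast_one, mul_one] at h

/-- In particular `ω·m ⊕ ω·n = ω·m + ω·n`: on multiples of `ω` the natural sum is the ordinal sum (unlike `1 ⊕ ω = ω + 1 ≠ 1 + ω`).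
[cite: Clark2015EuclideanOrderTypes, §1.2 Thm. 3 and Prop. 4 (b)] -/
theorem nadd_omega0_mul_natCast_eq_add (m n : ℕ) :
    nadd (ω * m : Ordinal.{u}) (ω * n) = ω * m + ω * n := by
  rw [nadd_omega0_mul_natCast, Nat.cast_add, mul_add]

end Literature.Order.Ordinal
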